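import Literature.Geometry.Lorentzian.CurvatureNaturality
import Literature.Geometry.Riemannian.ConstantCurvature
import HarnessLib

/-!
# Constant sectional curvature descends along surjective local isometries

O'Neill 1983, Ch. 3, Prop. 3.59 / Cor. 3.60: (local) isometries preserve the Riemann curvature
tensor; Lee 2018, Prop. 2.32 with Lemma 8.33 ff.: a Riemannian covering of a space of constant
curvature has constant curvature and conversely. In the tree's setting of
`CurvatureNaturality.lean` — `Φ : N → M` a `C^∞` equidimensional immersion, `g` a `C^∞` metric on
`M`, `Φ^*g = g.comap … Φ …` its pullback, `riemann_comap_apply`: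
`R^{Φ^*g}_u = (dΦ_u)⁻¹ ∘ R^g_{Φ u} ∘ (dΦ_u)^{⊗3}` — we prove the one consequence needed to pass
constant curvature from a cover to its quotient:

* `hasConstantSectionalCurvature_of_comap_of_surjective` — if `Φ` is moreover SURJECTIVE and
  `Φ^*g` has constant sectional curvature `c` (`PseudoRiemannianMetric.HasConstantSectionalCurvature`,
  `ConstantCurvature.lean`, quantified over all Levi-Civita connections) then so has `g`.

With `Literature/Geometry/Riemannian/QuotientMetric.lean` (`comap_mk_quotientMetric`:
`ḡ.comap mk = g` for the quotient metric of an isometric free properly discontinuous action) this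
gives: `M/G` has constant curvature `c` when `M` has. Proved; no named facts.

## References

* B. O'Neill, *Semi-Riemannian geometry* (1983), Ch. 3, Prop. 3.59, Cor. 3.60–3.61. [`ONeill1983`]
* J. M. Lee, *Introduction to Riemannian Manifolds*, 2nd ed. (2018), Prop. 2.32, Lemma 8.33,
  Prop. 8.36. [`Lee2018`]
-/

open scoped Manifold ContDiff Topology
open Set Function Bundle

noncomputable section

namespace Literature.Geometry.Riemannian

open Literature.Geometry.Lorentzian Literature.Geometry.Lorentzian.PseudoRiemannianMetric

variable {E : Type*} [NormedAddCommGroup E] [NormedSpace ℝ E] {H : Type*} [TopologicalSpace H]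
  {I : ModelWithCorners ℝ E H} {M : Type*} [TopologicalSpace M] [ChartedSpace H M]
  [IsManifold I ∞ M]
  {E' : Type*} [NormedAddCommGroup E'] [NormedSpace ℝ E'] {H' : Type*} [TopologicalSpace H']
  {I' : ModelWithCorners ℝ E' H'} {N : Type*} [TopologicalSpace N] [ChartedSpace H' N]
  [IsManifold I' ∞ N]
  [FiniteDimensional ℝ E] [FiniteDimensional ℝ E'] [CompleteSpace E] [CompleteSpace E']
  (g : PseudoRiemannianMetric I ∞ E (TangentSpace I : M → Type _))
  {Φ : N → M} (hpb : contMDiff_pullbackBilin I M I' N ∞) (hΦ : ContMDiff I' I (∞ + 1) Φ)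
  (hΦ' : ∀ u, Function.Injective (mfderiv I' I Φ u))
  (hdim : Module.finrank ℝ E' = Module.finrank ℝ E)

/-- **Constant sectional curvature descends along a surjective local isometry.** If
`Φ : (N, Φ^*g) → (M, g)` is a surjective equidimensional `C^∞` immersion (a surjective local
isometry for the pullback metric) and `Φ^*g` has constant sectional curvature `c`, then so has
`g`: `R^{Φ^*g}_u = (dΦ_u)⁻¹ ∘ R^g_{Φ u} ∘ dΦ_u^{⊗3}` (`riemann_comap_apply`, O'Neill 1983, Ch. 3,
Prop. 3.59: local isometries preserve curvature), every tangent vector at `Φ u` is a `dΦ_u v`,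
and every point is a `Φ u`. Stated for all Levi-Civita connections of `g`
(`IsLeviCivita.curvature_eq_riemann`). [cite: ONeill1983, Ch. 3, Prop. 3.59] -/
theorem hasConstantSectionalCurvature_of_comap_of_surjective (hsurj : Function.Surjective Φ)
    {c : ℝ} (h : (g.comap hpb Φ hΦ hΦ' hdim).HasConstantSectionalCurvature c) :
    g.HasConstantSectionalCurvature c := by
  intro cov hcov
  haveI := g.hasLeviCivita
  haveI := (g.comap hpb Φ hΦ hΦ' hdim).hasLeviCivita
  have h2 : (2 : ℕ∞ω) ≤ ∞ := WithTop.coe_le_coe.mpr le_top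
  intro x X Y Z W
  obtain ⟨u, rfl⟩ := hsurj x
  have hbij := mfderiv_bijective_of_injective (hΦ' u) hdim
  obtain ⟨X', rfl⟩ := hbij.2 X
  obtain ⟨Y', rfl⟩ := hbij.2 Y
  obtain ⟨Z', rfl⟩ := hbij.2 Z
  obtain ⟨W', rfl⟩ := hbij.2 W
  rw [curvatureForm, hcov.curvature_eq_riemann h2]
  have hinvA : (mfderiv I' I Φ u).IsInvertible := isInvertible_mfderiv_of_injective hdim (hΦ' u)
  have hAR : mfderiv I' I Φ u ((g.comap hpb Φ hΦ hΦ' hdim).riemann u X' Y' Z') =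
      g.riemann (Φ u) (mfderiv I' I Φ u X') (mfderiv I' I Φ u Y') (mfderiv I' I Φ u Z') := by
    rw [riemann_comap_apply g hpb hΦ hΦ' hdim u X' Y' Z']
    exact hinvA.self_apply_inverse _
  have hc := (h _ (isLeviCivita_leviCivita_holds (g := g.comap hpb Φ hΦ hΦ' hdim))) u X' Y' Z' W'
  rw [curvatureForm] at hc
  simp only [val_comap, pullbackBilin_apply] at hc
  rw [← hAR]
  exact hc

end Literature.Geometry.Riemannian
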